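import Summits.BirchSwinnertonDyer.BirchSwinnertonDyer.Theorems.QuadraticBranchSignedControlPlusEtaNonsurjConjADoorMinus
import HarnessLib

/-!
# Route `QuadraticBranchSignedControl` (rung K8, cell `bsd-potss`), residual crux `PlusEtaMainConjectureNonsurj`
# (stmt-BirchSwinnertonDyer-19606): DOOR L6⁻ ∘ FINE ROAD — the integral Kato inclusion at `η` and (C1⁺_η) on the prime-`L` rank-1,
# rank-0 and CM rank-0 shapes from the RELATIVE class-number datum (seat `bsd-potss-k8eta-c2` g21, sequel of `…ConjADoorMinus`)

WHAT. Part 1 (`EtaConjADoorMinus`, this seat) gives statement (A) for the partner `W` of a row `V` of crux 19606 from ONE datum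
«`v_p h(ℚ(P)) ≤ v_p h(ℚ(P)^σ)`» (`σ = τ|_{ℚ(P)}` for any `τ` acting as `−1` on `P`; `ℚ(P)^σ = ℚ(x(P))`), with no named fact. This file
feeds it to k8eta-c2 g6's fine road BY NAME exactly as p691623 (`…ConjADoorUpper`) did with the plain class number: the INTEGRAL Kato
inclusion at `η` (`h22 h41 h6273` + datum + analytic `μ`), (C1⁺_η) on the prime-`L` rank-1 shape (`h22 h41 h6273` + datum + `Sel_{p^∞}(W)`
infinite + `(L_p⁺(V,η,X)) = (X)`), the rank-0 shape (+ `hPT hmod hGZK hKO`, `L(W,1) ≠ 0`, `MissingLowerBoundAt W p`) and the CM rank-0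
shape (+ `hS28`).

SCOPE (numbers, not adjectives; k8eta-c2 g21 census, GRH class numbers): at `p = 5` the prime-`L` rank-1 shape now reaches the CM rows
260100e1, 326700fg1, 326700y1, 357075br1 and the UNCONGRUENT row u5a:−4 (`X_ns⁺(5)`, `t = 4/5`, twist `D = −4`; `ε = −1`, `λ⁺ = 1`,
`μ⁺ = 0`, `r_an(W) = 1`; `h(ℚ(P)) = 30`, `h(ℚ(x(P))) = 15`) — the first row of v7's hardest stub `stub_etaMC_nonCM_uncongruent` carried to
(C1⁺_η) by name (modulo `h22 h41 h6273 hGZK`, two GRH class numbers, PARI `(Lη) = (X)`, `r_an = 1`); the CM rank-0 shape reaches 378225bk1.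

HONEST FRAMING (cell `bsd-potss`; FULL-BSD rank ≤ 1 programme, HUMAN RULING D-0036/D-0074): TOOL THEOREMS ONLY — no definition, no named
fact, no `sorry`, axioms standard; CONDITIONAL on the displayed named facts and per-row data. No stub of 19606 is proved by name; the crux
stays OPEN; nothing is booked; (A) and `BSD(W,p)` are claimed for no pair. `--supports stmt-BirchSwinnertonDyer-19606 --as helper`.

References: [Kobayashi2003] Thm. 2.2 (p. 5), §4 Even main conjecture + Thm. 4.1 (p. 8), Thm. 6.2/6.3/7.3 i) (p. 13); [CoatesSujatha2005] §3 (A),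
Thm. 3.4; [GreenbergLNM1716] §4 Lemma 4.2; [KitajimaOtsuki2018] Thm. 1.3; [Miller2011LMS] Def. 1.1; [BurungaleFlach2024] Thm. 1.1.
-/

set_option autoImplicit false
set_option linter.dupNamespace false
noncomputable section

open scoped Classical

open NumberField IsDedekindDomain Field WeierstrassCurve
open Literature.NumberTheory.EllipticCurves Literature.NumberTheory.GaloisRepresentations
  Literature.NumberTheory.EllipticCurves.Rank1Residual Literature.NumberTheory.NumberFields
open Literature.NumberTheory.EllipticCurves.CoatesSujatha2005
open Summit.BirchSwinnertonDyer.Rank1Residual Summit.BirchSwinnertonDyer.Rank1Residual.GaloisImage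

namespace Summit.BirchSwinnertonDyer.BirchSwinnertonDyer.Theorems.EtaConjADoorMinus

variable (p : ℕ) [hp : Fact p.Prime]

/-! ## Door L6⁻ ∘ the fine road BY NAME (as p691623, with the relative class-number datum) -/

section Upper

open CongruenceSubgroup Literature.NumberTheory.EllipticCurves.ModularForms
  Literature.NumberTheory.EllipticCurves.Rank1Residual.Typed Literature.NumberTheory.GaloisCohomology
  Literature.NumberTheory.EllipticCurves.GreenbergVatsal2000 ZpExtension
open Summit.BirchSwinnertonDyer.Rank1Residual.Additive

variable (V : WeierstrassCurve ℚ) [V.IsElliptic] [V.IsGloballyMinimal] (W : WeierstrassCurve ℚ) [W.IsElliptic]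
  [W.IsGloballyMinimal] (C : VariableChange ℚ)

omit [W.IsGloballyMinimal] in
/-- **The INTEGRAL Kato-side inclusion at `η` on a row from the relative class-number datum and the analytic `μ`** — door L6⁻
(`conjA_partner_of_relClassNumber`) fed to k8eta-c2 g6's fine road `EtaFineRoad.etaUpperIntegral_of_conjA_of_analyticMu` (cf. p691623's
class-number form). Named facts `h22 h41 h6273`; displayed: the relative class-number datum, `μ_an = 0`. CONDITIONAL; nothing booked.
[cite: Kobayashi2003, Thm. 4.1 first display (p. 8), Thm. 2.2 (p. 5), Thm. 7.3 i) (7.21) (p. 13)] [cite: CoatesSujatha2005, §3 (A) and Thm. 3.4] -/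
theorem etaUpperIntegral_of_relClassNumber_of_analyticMu
    (h22 : Kobayashi2003.thm22_etaSignedSelmerDual_finite_torsion)
    (h41 : Kobayashi2003.thm41_plusEtaCharIdeal_dvd)
    (h6273 : Kobayashi2003.thm62_63_73_etaColemanPoitouTate)
    [NeZero p] (hp5 : 5 ≤ p) (hC : C • W.quadraticTwist ((-1) ^ (p / 2) * p) = V)
    (hgood : V.HasGoodReductionAtPrime p) (hap : V.frobeniusTrace p = 0)
    (hns : ¬ ∀ m : ℕ, V.HasSurjectiveModNGaloisRep (p ^ m : ℕ))
    (hP : haveI : NumberField (W.divisionField p) := NumberField.mk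
      ∃ P : geomTorsion W (p : ℤ), P ≠ 0 ∧ ∀ τ : absoluteGaloisGroup ℚ, τ • P = -P →
        ∀ K : IntermediateField ℚ (W.divisionField p),
          K = IntermediateField.fixedField
            ((MulAction.stabilizer (absoluteGaloisGroup ℚ) P).map (absRestrictNormalHom (W.divisionField p))) →
        ∀ σ : K ≃ₐ[ℚ] K,
          (∀ x : K, absRestrictNormalHom (W.divisionField p) τ (x : W.divisionField p) =
            ((σ x : K) : W.divisionField p)) →
          padicValNat p (NumberField.classNumber K) ≤
            padicValNat p (NumberField.classNumber (IntermediateField.fixedField (Subgroup.zpowers σ))))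
    (hμan : ∀ {N : ℕ} [NeZero N] {f : CuspForm (Gamma0 N) 2}, IsNewformOf V f →
      ∀ (ϖ : ℚ), (if Even (p / 2) then (ϖ : ℝ) * V.realPeriodRat = plusPeriod f
          else (ϖ : ℝ) * V.imaginaryPeriodRat = minusPeriod f) →
      ∀ (Lη : IwasawaAlgebra p), IsQuadraticBranchPlusLFunction f p ϖ Lη → HasUnitContent Lη) :
    ∀ (K₀ : Type) [Field K₀] [NumberField K₀] [IsCyclotomicExtension {p} ℚ K₀]
        [(galRange (K := ℚ) K₀).Normal] (ηq : absoluteGaloisGroup ℚ →* ℤˣ),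
        (∀ σ ∈ galRange (K := ℚ) K₀, ηq σ = 1) → ηq ≠ 1 →
      ∀ {N : ℕ} [NeZero N] {f : CuspForm (Gamma0 N) 2},
        p ≠ 2 → V.HasGoodReductionAtPrime p → V.frobeniusTrace p = 0 → IsNewformOf V f →
      ∀ (ϖ : ℚ), (if Even (p / 2) then (ϖ : ℝ) * V.realPeriodRat = plusPeriod f
          else (ϖ : ℝ) * V.imaginaryPeriodRat = minusPeriod f) →
      ∀ (Lη : IwasawaAlgebra p), IsQuadraticBranchPlusLFunction f p ϖ Lη →
      ∀ (κ : ZpExtension ℚ p) (γ : absoluteGaloisGroup ℚ),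
        κ.IsCyclotomic → κ.IsTopGenerator γ → γ ∈ galRange (K := ℚ) K₀ → IsCyclotomicVariable p γ →
      ∀ (D : EtaSignedSelmerDualData V κ K₀ ℚ_[p] ηq γ 1), Ideal.span {Lη} ≤ D.charIdeal :=
  EtaFineRoad.etaUpperIntegral_of_conjA_of_analyticMu W p h22 h41 h6273 V C hC
    (conjA_partner_of_relClassNumber p V W C hp5 hC hgood hap hns hP) hμan

omit [W.IsGloballyMinimal] in
/-- **Prime-`L` rank-`1` shape: (C1⁺_η)(V) from the relative class-number datum ALONE** (granted `h22 h41 h6273`): `Sel_{p^∞}(W/ℚ)`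
infinite and `(L_p⁺(V,η,X)) = (X)` + the datum ⟹ `QuadraticBranchPlusEtaMainConjectureAt V p` — door L6⁻ fed to
`EtaFineRoad.quadraticBranchPlusEtaMainConjectureAt_of_span_eq_span_X_of_conjA`. This is the shape that reaches the UNCONGRUENT rank-1 rows
(census k8eta-c2 g21: u5a:−4, the first row of v7's `stub_etaMC_nonCM_uncongruent` domain carried to (C1⁺_η) by name). CONDITIONAL; nothing booked.
[cite: Kobayashi2003, §4 Even main conjecture and Thm. 4.1 first display (p. 8), Thm. 7.3 i) (p. 13)] [cite: CoatesSujatha2005, §3 statement (A)]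
[cite: GreenbergLNM1716, §4 Lemma 4.2 (p. 102)] -/
theorem quadraticBranchPlusEtaMainConjectureAt_of_relClassNumber_of_span_eq_span_X
    (h22 : Kobayashi2003.thm22_etaSignedSelmerDual_finite_torsion)
    (h41 : Kobayashi2003.thm41_plusEtaCharIdeal_dvd)
    (h6273 : Kobayashi2003.thm62_63_73_etaColemanPoitouTate)
    [NeZero p] (hp5 : 5 ≤ p) (hC : C • W.quadraticTwist ((-1) ^ (p / 2) * p) = V)
    (hgood : V.HasGoodReductionAtPrime p) (hap : V.frobeniusTrace p = 0)
    (hns : ¬ ∀ m : ℕ, V.HasSurjectiveModNGaloisRep (p ^ m : ℕ))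
    (hinf : ¬ Finite ↥(W.selmerGroupPInfty p))
    (hX : ∀ {N : ℕ} [NeZero N] {f : CuspForm (Gamma0 N) 2}, IsNewformOf V f →
      ∀ (ϖ : ℚ), (if Even (p / 2) then (ϖ : ℝ) * V.realPeriodRat = plusPeriod f
          else (ϖ : ℝ) * V.imaginaryPeriodRat = minusPeriod f) →
      ∀ (Lη : IwasawaAlgebra p), IsQuadraticBranchPlusLFunction f p ϖ Lη →
        Ideal.span {Lη} = Ideal.span {(PowerSeries.X : IwasawaAlgebra p)})
    (hP : haveI : NumberField (W.divisionField p) := NumberField.mk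
      ∃ P : geomTorsion W (p : ℤ), P ≠ 0 ∧ ∀ τ : absoluteGaloisGroup ℚ, τ • P = -P →
        ∀ K : IntermediateField ℚ (W.divisionField p),
          K = IntermediateField.fixedField
            ((MulAction.stabilizer (absoluteGaloisGroup ℚ) P).map (absRestrictNormalHom (W.divisionField p))) →
        ∀ σ : K ≃ₐ[ℚ] K,
          (∀ x : K, absRestrictNormalHom (W.divisionField p) τ (x : W.divisionField p) =
            ((σ x : K) : W.divisionField p)) →
          padicValNat p (NumberField.classNumber K) ≤
            padicValNat p (NumberField.classNumber (IntermediateField.fixedField (Subgroup.zpowers σ)))) :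
    QuadraticBranchPlusEtaMainConjectureAt V p :=
  EtaFineRoad.quadraticBranchPlusEtaMainConjectureAt_of_span_eq_span_X_of_conjA W p h22 h41 h6273 V C hp5 hC hgood hap
    hinf hX (conjA_partner_of_relClassNumber p V W C hp5 hC hgood hap hns hP)

/-- **Rank-`0` shape: (C1⁺_η)(V) from the relative class-number datum, the analytic `μ`, `L(W,1) ≠ 0` and the lower bound `L₀(W,p)`** —
door L6⁻ fed to `EtaFineRoad.quadraticBranchPlusEtaMainConjectureAt_of_conjA_of_analyticMu_of_missingLowerBoundAt`. Named facts
`hPT hmod hGZK h22 h41 hKO h6273`. CONDITIONAL; nothing booked. [cite: Kobayashi2003, §4 Even main conjecture and Thm. 4.1 (p. 8), Thm. 7.3 i) (p. 13)]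
[cite: CoatesSujatha2005, §3 statement (A)] [cite: Miller2011LMS, Def. 1.1] -/
theorem quadraticBranchPlusEtaMainConjectureAt_of_relClassNumber_of_analyticMu_of_missingLowerBoundAt
    (hPT : poitouTate_selmerStructure_duality_real ℚ) (hmod : hasEntireLFunction_rat)
    (hGZK : rank_eq_analyticRank_of_analyticRank_le_one)
    (h22 : Kobayashi2003.thm22_etaSignedSelmerDual_finite_torsion)
    (h41 : Kobayashi2003.thm41_plusEtaCharIdeal_dvd)
    (hKO : KitajimaOtsuki2018.mainThm13_etaSignedSelmerDual_noFiniteSubmodule)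
    (h6273 : Kobayashi2003.thm62_63_73_etaColemanPoitouTate)
    [NeZero p] (hp5 : 5 ≤ p) (hC : C • W.quadraticTwist ((-1) ^ (p / 2) * p) = V)
    (hgood : V.HasGoodReductionAtPrime p) (hap : V.frobeniusTrace p = 0)
    (hns : ¬ ∀ m : ℕ, V.HasSurjectiveModNGaloisRep (p ^ m : ℕ))
    (hP : haveI : NumberField (W.divisionField p) := NumberField.mk
      ∃ P : geomTorsion W (p : ℤ), P ≠ 0 ∧ ∀ τ : absoluteGaloisGroup ℚ, τ • P = -P →
        ∀ K : IntermediateField ℚ (W.divisionField p),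
          K = IntermediateField.fixedField
            ((MulAction.stabilizer (absoluteGaloisGroup ℚ) P).map (absRestrictNormalHom (W.divisionField p))) →
        ∀ σ : K ≃ₐ[ℚ] K,
          (∀ x : K, absRestrictNormalHom (W.divisionField p) τ (x : W.divisionField p) =
            ((σ x : K) : W.divisionField p)) →
          padicValNat p (NumberField.classNumber K) ≤
            padicValNat p (NumberField.classNumber (IntermediateField.fixedField (Subgroup.zpowers σ))))
    (hμan : ∀ {N : ℕ} [NeZero N] {f : CuspForm (Gamma0 N) 2}, IsNewformOf V f →
      ∀ (ϖ : ℚ), (if Even (p / 2) then (ϖ : ℝ) * V.realPeriodRat = plusPeriod f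
          else (ϖ : ℝ) * V.imaginaryPeriodRat = minusPeriod f) →
      ∀ (Lη : IwasawaAlgebra p), IsQuadraticBranchPlusLFunction f p ϖ Lη → HasUnitContent Lη)
    (hLW : W.entireLFunction 1 ≠ 0) (hlow : MissingLowerBoundAt W p) :
    QuadraticBranchPlusEtaMainConjectureAt V p :=
  EtaFineRoad.quadraticBranchPlusEtaMainConjectureAt_of_conjA_of_analyticMu_of_missingLowerBoundAt W p hPT hmod hGZK h22
    h41 hKO h6273 V C hp5 hC hgood hap
    (conjA_partner_of_relClassNumber p V W C hp5 hC hgood hap hns hP) hμan hLW hlow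

/-- **CM rank-`0` shape: (C1⁺_η)(V) from the relative class-number datum, the analytic `μ` and `L(W,1) ≠ 0`** (the lower half is bsd.S28) —
door L6⁻ fed to `EtaFineRoad.quadraticBranchPlusEtaMainConjectureAt_of_conjA_of_analyticMu_of_hasCM_rankZero` (census g21: row 378225bk1).
Named facts `hPT hmod hGZK h22 h41 hKO hS28 h6273`. CONDITIONAL; nothing booked. [cite: Kobayashi2003, §4 Even main conjecture and Thm. 4.1 (p. 8)]
[cite: BurungaleFlach2024, Thm 1.1 and Cor. 2] [cite: CoatesSujatha2005, §3 statement (A)] -/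
theorem quadraticBranchPlusEtaMainConjectureAt_of_relClassNumber_of_analyticMu_of_hasCM_rankZero
    (hPT : poitouTate_selmerStructure_duality_real ℚ) (hmod : hasEntireLFunction_rat)
    (hGZK : rank_eq_analyticRank_of_analyticRank_le_one)
    (h22 : Kobayashi2003.thm22_etaSignedSelmerDual_finite_torsion)
    (h41 : Kobayashi2003.thm41_plusEtaCharIdeal_dvd)
    (hKO : KitajimaOtsuki2018.mainThm13_etaSignedSelmerDual_noFiniteSubmodule)
    (hS28 : bsdTriple_of_hasCM_of_L_one_ne_zero)
    (h6273 : Kobayashi2003.thm62_63_73_etaColemanPoitouTate)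
    [NeZero p] (hp5 : 5 ≤ p) (hC : C • W.quadraticTwist ((-1) ^ (p / 2) * p) = V)
    (hgood : V.HasGoodReductionAtPrime p) (hap : V.frobeniusTrace p = 0)
    (hns : ¬ ∀ m : ℕ, V.HasSurjectiveModNGaloisRep (p ^ m : ℕ)) (hCM : V.HasCM)
    (hP : haveI : NumberField (W.divisionField p) := NumberField.mk
      ∃ P : geomTorsion W (p : ℤ), P ≠ 0 ∧ ∀ τ : absoluteGaloisGroup ℚ, τ • P = -P →
        ∀ K : IntermediateField ℚ (W.divisionField p),
          K = IntermediateField.fixedField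
            ((MulAction.stabilizer (absoluteGaloisGroup ℚ) P).map (absRestrictNormalHom (W.divisionField p))) →
        ∀ σ : K ≃ₐ[ℚ] K,
          (∀ x : K, absRestrictNormalHom (W.divisionField p) τ (x : W.divisionField p) =
            ((σ x : K) : W.divisionField p)) →
          padicValNat p (NumberField.classNumber K) ≤
            padicValNat p (NumberField.classNumber (IntermediateField.fixedField (Subgroup.zpowers σ))))
    (hμan : ∀ {N : ℕ} [NeZero N] {f : CuspForm (Gamma0 N) 2}, IsNewformOf V f →
      ∀ (ϖ : ℚ), (if Even (p / 2) then (ϖ : ℝ) * V.realPeriodRat = plusPeriod f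
          else (ϖ : ℝ) * V.imaginaryPeriodRat = minusPeriod f) →
      ∀ (Lη : IwasawaAlgebra p), IsQuadraticBranchPlusLFunction f p ϖ Lη → HasUnitContent Lη)
    (hLW : W.entireLFunction 1 ≠ 0) :
    QuadraticBranchPlusEtaMainConjectureAt V p :=
  EtaFineRoad.quadraticBranchPlusEtaMainConjectureAt_of_conjA_of_analyticMu_of_hasCM_rankZero W p hPT hmod hGZK h22 h41
    hKO hS28 h6273 V C hp5 hC hgood hap hCM
    (conjA_partner_of_relClassNumber p V W C hp5 hC hgood hap hns hP) hμan hLW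

end Upper

end Summit.BirchSwinnertonDyer.BirchSwinnertonDyer.Theorems.EtaConjADoorMinus

end
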